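import Literature.AnabelianGeometry.AbsoluteAnabelian.AbsTopISemiAbsolute
import Literature.AnabelianGeometry.AbsoluteAnabelian.LocalClassFieldTheoryForms
import Literature.AnabelianGeometry.AbsoluteAnabelian.LocalReciprocityCompletionProofs
import Literature.AnabelianGeometry.AbsoluteAnabelian.FreeProlRankCompletionProofs
import Literature.AnabelianGeometry.AbsoluteAnabelian.MLFIntegerLatticeProofs
import Literature.AnabelianGeometry.AbsoluteAnabelian.MLFUnitGroupRankBoundProofs
import Literature.AnabelianGeometry.AbsoluteAnabelian.MLFUnitGroupRankWitnessProofs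
import Literature.AnabelianGeometry.AbsoluteAnabelian.MLFGaloisGroupsProofs
import Literature.NumberTheory.GaloisRepresentations.LocalFieldFiniteExtension
import Literature.NumberTheory.GaloisRepresentations.LocalFieldPadicProofs
import HarnessLib

/-!
# [AbsTopI] Thm 2.6 (ii): `δ¹_l(G_k) = 1` (`l ≠ p`), `δ¹_p(G_k) = [k : ℚ_p] + 1` — DISCHARGED

S. Mochizuki, *Topics in Absolute Anabelian Geometry I: Generalities* (2012) [AbsTopI], Thm 2.6
(ii) p. 21 (manuscript pagination, lit key paper:url-11ac98ba15fc), for `k` an MLF of residue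
characteristic `p`: "`δ¹_l(G) = 1` if `l ≠ p`, `δ¹_p(G) = [k : ℚ_p] + 1`" — in the proof (p. 23)
"the well-known fact … cf. our discussion of local class field theory"; [AbsAnab] Lemma 1.1.4
(ii) proof p. 8 uses the same ranks "`dim_{ℚ_l}((G′)^{ab} ⊗ ℚ_l)`".  The statement file
`AbsTopISemiAbsolute.lean` (abc-iut-L4-t4, p405607) records this as the closed named fact
`FundamentalExtension.thm26_ii_delta_gal` (LCFT form L6 of `LocalClassFieldTheoryForms.lean`),
with `δ¹_l = freeProlRank` (`ProfiniteTerminology.lean`: the supremum of the `n` with a continuous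
surjection onto `ℤ_lⁿ`); it is the hypothesis `hR` of abc-iut-L4-t11's conditional discharges of
[AbsAnab] Prop 1.2.1 (i)(ii)(v) and Lemma 1.1.4 (ii) (`MLFGaloisGroupsProofs.lean`, …).

This proof-only file PROVES it:

* `thm26_ii_delta_gal_of_reciprocity_completion : mlf_reciprocity_completion → thm26_ii_delta_gal`
  — the deduction from local class field theory in the completed form
  `(k^×)^∧ ≅ G_k^{ab}` ([AbsAnab] §1.2 p. 9, named fact L1);
* `thm26_ii_delta_gal_holds : thm26_ii_delta_gal` — UNCONDITIONAL, since L1 is itself proved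
  in the tree (`mlf_reciprocity_completion_holds`, abc-iut-L4-d1, from the
  `Literature.NumberTheory.GaloisRepresentations` local class field theory trunk).

Chain: `δ¹_l(G_k) = δ¹_l(G_k^{ab})` (`freeProlRank_topologicalAbelianization`) `= δ¹_l((k^×)^∧)`
(transport along L1) `= sup {n : ∃ k^× → ℤ_lⁿ with dense image}` (`freeProlRank_profiniteCompletion`);
on the `k^×` side `k^× ≅ ℤ × 𝒪_k^×`, `𝒪_k^× ⊇ U₂ ≃ ℤ_p^{[k:ℚ_p]}` of finite index
(`exists_oneUnits_continuousMulEquiv`), whence the bounds `n ≤ 1` / `n ≤ [k:ℚ_p] + 1`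
(`le_one_of_denseRange_of_units`, `le_succ_of_denseRange_of_units`) and the witnesses
(`exists_denseRange_units_padicInt_one`, `exists_denseRange_units_padicInt_succ`).  The binder
form `(p) [Algebra ℚ_[p] K] [FiniteDimensional ℚ_[p] K]` of the named fact is bridged to the
tree's valued model by `FiniteExtension.valuativeRel/topologicalSpace/isNonarchimedeanLocalField`
and `Padic.isNonarchimedeanLocalField_holds` (the absolute Galois group does not depend on the
valued structure).

Theorems only; nothing of the statement files is restated.  HONEST FRAMING: a kernel check of a
classical theorem of local class field theory; nothing here bears on [IUTchIII] Cor. 3.12.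
-/

noncomputable section

open ValuativeRel Field

namespace Literature.AnabelianGeometry.AbsoluteAnabelian

open Literature.NumberTheory.GaloisRepresentations

/-! ### The `k^×` side: `δ¹_l((k^×)^∧)` -/

section UnitsSide

variable (p : ℕ) [Fact p.Prime]
variable (K : Type) [Field K] [ValuativeRel K] [TopologicalSpace K] [IsNonarchimedeanLocalField K]
  [Algebra ℚ_[p] K] [FiniteDimensional ℚ_[p] K]

/-- `δ¹_l((k^×)^∧) = 1` for a prime `l ≠ p` and a finite extension `k/ℚ_p` (as a local field):
the `k^×` side of [AbsTopI] Thm 2.6 (ii) "`δ¹_l(G) = 1` if `l ≠ p`".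
[cite: MochizukiAbsTopI2012, Thm 2.6 (ii) p.21] -/
theorem freeProlRank_completion_units_of_ne (l : ℕ) [Fact l.Prime] (hl : l ≠ p) :
    freeProlRank (ProfiniteGrp.ProfiniteCompletion.completion (GrpCat.of Kˣ)) l = 1 := by
  obtain ⟨W, -, hWi, ⟨eW⟩⟩ := exists_oneUnits_continuousMulEquiv p K
  refine le_antisymm ?_ ?_
  · refine freeProlRank_profiniteCompletion_le_of_forall Kˣ l fun n f hf => ?_
    have h := le_one_of_denseRange_of_units K hl W eW.toMulEquiv f hf
    exact_mod_cast h
  · obtain ⟨f, hf⟩ := exists_denseRange_units_padicInt_one K l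
    have h := le_freeProlRank_profiniteCompletion_of_denseRange Kˣ l f hf
    exact_mod_cast h

/-- `δ¹_p((k^×)^∧) = [k : ℚ_p] + 1` for a finite extension `k/ℚ_p` (as a local field): the
`k^×` side of [AbsTopI] Thm 2.6 (ii) "`δ¹_p(G) = [k : ℚ_p] + 1`".
[cite: MochizukiAbsTopI2012, Thm 2.6 (ii) p.21] -/
theorem freeProlRank_completion_units_self :
    freeProlRank (ProfiniteGrp.ProfiniteCompletion.completion (GrpCat.of Kˣ)) p =
      (Module.finrank ℚ_[p] K + 1 : ℕ) := by
  obtain ⟨W, -, hWi, ⟨eW⟩⟩ := exists_oneUnits_continuousMulEquiv p K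
  refine le_antisymm ?_ ?_
  · refine freeProlRank_profiniteCompletion_le_of_forall Kˣ p fun n f hf => ?_
    have h := le_succ_of_denseRange_of_units K W eW.toMulEquiv f hf
    exact_mod_cast h
  · obtain ⟨f, hf⟩ := exists_denseRange_units_padicInt_succ K W eW.toMulEquiv
    have h := le_freeProlRank_profiniteCompletion_of_denseRange Kˣ p f hf
    exact_mod_cast h

/-! ### The Galois side, relative to L1 -/

/-- [AbsTopI] Thm 2.6 (ii)'s rank formula for `G_k`, `k` a finite extension of `ℚ_p` carrying its
local-field structure, RELATIVE TO the completed reciprocity isomorphism `(k^×)^∧ ≅ G_k^{ab}`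
(L1, [AbsAnab] §1.2 p. 9): `δ¹_l(G_k) = δ¹_l(G_k^{ab}) = δ¹_l((k^×)^∧)`.
[cite: MochizukiAbsTopI2012, Thm 2.6 (ii) p.21] -/
theorem freeProlRank_absoluteGaloisGroup_of_reciprocity_completion
    (hL1 : mlf_reciprocity_completion.{0}) :
    (∀ (l : ℕ) [Fact l.Prime], l ≠ p → freeProlRank (absoluteGaloisGroup K) l = 1) ∧
      freeProlRank (absoluteGaloisGroup K) p = (Module.finrank ℚ_[p] K + 1 : ℕ) := by
  haveI : CharZero K := charZero_of_injective_algebraMap (algebraMap ℚ_[p] K).injective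
  obtain ⟨e, -⟩ := hL1 K
  have htrans : ∀ (l : ℕ) [Fact l.Prime], freeProlRank (absoluteGaloisGroup K) l =
      freeProlRank (ProfiniteGrp.ProfiniteCompletion.completion (GrpCat.of Kˣ)) l := by
    intro l _
    rw [← freeProlRank_topologicalAbelianization (G := absoluteGaloisGroup K) l]
    exact (freeProlRank_eq_of_continuousMulEquiv e l).symm
  refine ⟨fun l _ hl => ?_, ?_⟩
  · rw [htrans l]
    exact freeProlRank_completion_units_of_ne p K l hl
  · rw [htrans p]
    exact freeProlRank_completion_units_self p K

end UnitsSide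

/-! ### The named fact -/

/-- **[AbsTopI] Thm 2.6 (ii), "the well-known fact" — DEDUCED from local class field theory
(L1, `(k^×)^∧ ≅ G_k^{ab}`)**: for `k` a finite extension of `ℚ_p`, `δ¹_l(G_k) = 1` for `l ≠ p` and
`δ¹_p(G_k) = [k : ℚ_p] + 1` (`δ¹_l = freeProlRank`).  The binder form of the named fact
`FundamentalExtension.thm26_ii_delta_gal` is bridged to the valued model by the tree's
`FiniteExtension.isNonarchimedeanLocalField` over `Padic.isNonarchimedeanLocalField_holds`.
[cite: MochizukiAbsTopI2012, Thm 2.6 (ii) p.21] -/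
theorem thm26_ii_delta_gal_of_reciprocity_completion (hL1 : mlf_reciprocity_completion.{0}) :
    FundamentalExtension.thm26_ii_delta_gal := by
  intro p _ K _ _ _
  haveI : IsNonarchimedeanLocalField ℚ_[p] := Padic.isNonarchimedeanLocalField_holds p
  letI := FiniteExtension.valuativeRel ℚ_[p] K
  letI := FiniteExtension.topologicalSpace ℚ_[p] K
  haveI : IsNonarchimedeanLocalField K := FiniteExtension.isNonarchimedeanLocalField ℚ_[p] K
  obtain ⟨h1, h2⟩ := freeProlRank_absoluteGaloisGroup_of_reciprocity_completion p K hL1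
  exact ⟨fun l _ hl => h1 l hl, h2⟩

/-- **[AbsTopI] Thm 2.6 (ii), "the well-known fact" — UNCONDITIONAL**: `δ¹_l(G_k) = 1` (`l ≠ p`),
`δ¹_p(G_k) = [k : ℚ_p] + 1` for every finite extension `k/ℚ_p`, i.e. the named fact
`FundamentalExtension.thm26_ii_delta_gal` HOLDS: L1 is proved in the tree
(`mlf_reciprocity_completion_holds`, abc-iut-L4-d1, from the local class field theory trunk).
This removes the hypothesis `hR` from abc-iut-L4-t11's discharges of [AbsAnab] Prop 1.2.1
(i)(v) (`galoisMLF_iso_residueChar_eq_of_rank`, …). [cite: MochizukiAbsTopI2012, Thm 2.6 (ii) p.21] -/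
theorem thm26_ii_delta_gal_holds : FundamentalExtension.thm26_ii_delta_gal :=
  thm26_ii_delta_gal_of_reciprocity_completion mlf_reciprocity_completion_holds.{0}

end Literature.AnabelianGeometry.AbsoluteAnabelian
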